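import Summits.AtomisticToContinuum.FouriersLaw.Theorems.BondHeatUncertaintyLinearResponseFTURK3Limits
import Summits.AtomisticToContinuum.FouriersLaw.Theorems.BondHeatUncertaintyLinearResponseFTURFatouSandwich

/-!
# The two integral inequalities of the anti-damped Girsanov formula (K3 helper)

Helper file for stub `stub_antiDampedGirsanov` (K3) of line `lebesgue-flip-duality`, crux ★
`BondHeatUncertainty.LinearResponseFTUR` (stmt-AtomisticToContinuum-9122); sequel of `…K3Limits.lean`.
For every bounded continuous `G ≥ 0` on the observable space, with `X = fwdPath` (damped) and
`Z = thetaRevPath` (anti-damped) from `y`, `W = Q_L/T_L + Q_R/T_R`: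

* `lintegral_obs_fwd_weighted_le` (I):  `E[G(obs X) e^{W(obs X) - 2γt}] ≤ E[G(obs Z)]`;
* `lintegral_obs_anti_weighted_le` (II): `E[G(obs Z) e^{-W(obs Z) + 2γt}] ≤ E[G(obs X)]`.

Each is the Fatou sandwich `lintegral_le_of_sandwich` fed with a reweighting identity of
`…DiscreteIdentity.lean` (equal integrals of the two scheme functionals), the limits of `…K3Limits.lean`
(on the good events, almost surely through the dyadic quadratic variation of the two Brownian
coordinates) and the exhaustion of the raw sample space by the good events.
-/

noncomputable section

namespace Summit.AtomisticToContinuum.FouriersLaw.Theorems.LinearResponseFTUR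

open MeasureTheory Filter Set Function Finset intervalIntegral Topology Metric BoundedContinuousFunction
open scoped NNReal ENNReal
open Literature.MathematicalPhysics.KineticTheory
open Literature.MathematicalPhysics.KineticTheory.HeatConduction
open Literature.Probability.Process
open Literature.Analysis.ODE
open Summit.AtomisticToContinuum.FouriersLaw.Theorems.BondHeatUncertainty
open Summit.AtomisticToContinuum.FouriersLaw.Theorems.SubdiffusiveBondHeat

variable {N : ℕ}

/-! ### Measurability -/

section Meas

variable {ω₂ lam β : ℝ} (hω : 0 < ω₂) (hl : 0 ≤ lam) (hβ : 0 ≤ β) (γ : ℝ) (N : ℕ) (T_L T_R R t : ℝ)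
  (i0 iN ib : Fin N) (y : PhaseSpace N)
include hω hl hβ

/-- The raw observable of a scheme path is measurable in the finite increment vector. -/
theorem measurable_rawObs_path_extIncr (ε σ : ℝ) (m : ℕ) (t' : ℝ) :
    Measurable fun x : Fin (2 ^ m) → ℝ × ℝ => rawObs (pinnedChain ω₂ lam β γ) N i0 iN ib t' y
      ((dyScheme ω₂ lam β γ N T_L T_R R t m).path ε σ (2 ^ m) y (extIncr (2 ^ m) x)) := by
  set D := dyScheme ω₂ lam β γ N T_L T_R R t m
  have hξ : ∀ j, Measurable fun x : Fin (2 ^ m) → ℝ × ℝ => extIncr (2 ^ m) x j := measurable_extIncr_apply _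
  have hp := fun s => SchemeData.measurable_path (D := D) (ε := ε) (σ := σ) (M := 2 ^ m) (y := y)
    (frictionless hω hl hβ N) rfl hξ s
  have hI := fun {f : PhaseSpace N → ℝ} (hf : Continuous f) => SchemeData.measurable_pathIntegral (D := D)
    (ε := ε) (σ := σ) (M := 2 ^ m) (y := y) (frictionless hω hl hβ N) rfl hξ hf t'
  exact measurable_const.prodMk ((hp t').prodMk ((hI (((continuous_apply i0).comp continuous_snd).mul
    (continuous_partialQ_pinned N ω₂ lam β γ i0))).prodMk ((hI (((continuous_apply iN).comp continuous_snd).mul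
    (continuous_partialQ_pinned N ω₂ lam β γ iN))).prodMk (hI (continuous_bondCurrent_pinned N ω₂ lam β γ ib)))))

/-- The raw observable of the scheme path is measurable in the raw sample. -/
theorem measurable_rawObs_schemePath (ε σ : ℝ) (m : ℕ) (t' : ℝ) :
    Measurable fun w : WienerPair => rawObs (pinnedChain ω₂ lam β γ) N i0 iN ib t' y
      (schemePath ω₂ lam β γ N T_L T_R R t ε σ m y w) :=
  (measurable_rawObs_path_extIncr hω hl hβ γ N T_L T_R R t i0 iN ib y ε σ m t').comp (measurable_pairGridIncr _ _)

/-- The exponent `logW` is measurable in the raw sample. -/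
theorem measurable_logW (ε σ : ℝ) (m : ℕ) :
    Measurable fun w : WienerPair => logW ω₂ lam β γ N T_L T_R R t ε σ m y w := by
  unfold logW
  set D := dyScheme ω₂ lam β γ N T_L T_R R t m
  have hSP : Measurable fun w : WienerPair => D.shiftPart ε σ (2 ^ m) y (pairGridIncr (2 ^ m) (t / 2 ^ m) w) :=
    (SchemeData.measurable_shiftPart (D := D) (frictionless hω hl hβ N) rfl ε σ (2 ^ m) y).comp
      (measurable_pairGridIncr _ _)
  have hξ := measurable_pairGridIncr (2 ^ m) (t / 2 ^ m)
  refine Finset.measurable_sum _ fun k _ => ?_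
  have h1 : Measurable fun w : WienerPair => (D.shiftPart ε σ (2 ^ m) y (pairGridIncr (2 ^ m) (t / 2 ^ m) w) k).1 :=
    measurable_fst.comp ((measurable_pi_apply k).comp hSP)
  have h2 : Measurable fun w : WienerPair => (D.shiftPart ε σ (2 ^ m) y (pairGridIncr (2 ^ m) (t / 2 ^ m) w) k).2 :=
    measurable_snd.comp ((measurable_pi_apply k).comp hSP)
  have h3 : Measurable fun w : WienerPair => (pairGridIncr (2 ^ m) (t / 2 ^ m) w k).1 :=
    measurable_fst.comp ((measurable_pi_apply k).comp hξ)
  have h4 : Measurable fun w : WienerPair => (pairGridIncr (2 ^ m) (t / 2 ^ m) w k).2 :=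
    measurable_snd.comp ((measurable_pi_apply k).comp hξ)
  exact ((((measurable_const.mul h1).mul h3).sub (h1.pow_const 2)).add
    (((measurable_const.mul h2).mul h4).sub (h2.pow_const 2))).div_const _

end Meas

/-! ### The good events -/

/-- The good event of a process: both bath momenta stay in `[-(R-1), R-1]` on `[0, t]`. -/
def bathGood (i0 iN : Fin N) (t : ℝ) (U : WienerPair → ℝ → PhaseSpace N) (R : ℕ) : Set WienerPair :=
  {w | ∀ s ∈ Icc 0 t, |(U w s).2 i0| ≤ (R : ℝ) - 1 ∧ |(U w s).2 iN| ≤ (R : ℝ) - 1}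

/-- The heat functional is continuous. -/
theorem continuous_heatFunctional (T_L T_R : ℝ) (i0 iN : Fin N) : Continuous (heatFunctional (N := N) T_L T_R i0 iN) := by
  unfold heatFunctional leftHeat rightHeat
  fun_prop

section Good

variable {ω₂ lam β γ : ℝ} (hω : 0 < ω₂) (hl : 0 ≤ lam) (hβ : 0 ≤ β) (hγ : 0 ≤ γ) (T_L T_R : ℝ)
  (i0 iN : Fin N) {t : ℝ} (ht : 0 ≤ t) (y : PhaseSpace N)
include hω hl hβ hγ

/-- The forward path at a fixed time is measurable in the raw sample. -/
theorem measurable_fwdPath_apply (s : ℝ) :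
    Measurable fun w : WienerPair => fwdPath (pinnedChain ω₂ lam β γ) N T_L T_R y w s := by
  have h := ((pinnedChain_isConfining hω hl hβ hγ).confinedDrift N).toConfinedDrift.measurable_sdeSolMap_pairPath_right
    ((pinnedChain_isConfining hω hl hβ hγ).bathVec_mem_noise N _ _)
    ((pinnedChain_isConfining hω hl hβ hγ).bathVec_mem_noise N _ _) s y
    (v₁ := (pinnedChain ω₂ lam β γ).bathVecL N T_L) (v₂ := (pinnedChain ω₂ lam β γ).bathVecR N T_R)
  simp only [fwdPath, ← pinnedChain_langevinSolMap_eq_solMap]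
  exact h

/-- The anti-damped path at a fixed time is measurable in the raw sample. -/
theorem measurable_thetaRevPath_apply (s : ℝ) :
    Measurable fun w : WienerPair => thetaRevPath ω₂ lam β γ N T_L T_R y w s := by
  have h := ((pinnedChain_isConfining hω hl hβ hγ).reversedDrift N).toConfinedDrift.measurable_sdeSolMap_pairPath_right
    ((pinnedChain_isConfining hω hl hβ hγ).bathVec_mem_reversedDrift_noise N _ _)
    ((pinnedChain_isConfining hω hl hβ hγ).bathVec_mem_reversedDrift_noise N _ _) s (y.1, -y.2)
    (v₁ := (pinnedChain ω₂ lam β γ).bathVecL N T_L) (v₂ := (pinnedChain ω₂ lam β γ).bathVecR N T_R)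
  exact (thetaCLM N).continuous.measurable.comp h

omit hω hl hβ hγ in
include ht in
/-- The good events are measurable for a process with continuous paths and measurable marginals. -/
theorem measurableSet_bathGood {U : WienerPair → ℝ → PhaseSpace N} (hc : ∀ w, Continuous (U w))
    (hm : ∀ s, Measurable fun w => U w s) (R : ℕ) : MeasurableSet (bathGood i0 iN t U R) := by
  have h1 := measurableSet_forall_Icc_le (u := fun s w => |(U w s).2 i0|)
    (fun w => (continuous_abs.comp ((continuous_apply i0).comp (continuous_snd.comp (hc w)))))
    (fun s => (continuous_abs.measurable.comp ((measurable_pi_apply i0).comp (measurable_snd.comp (hm s))))) ht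
    ((R : ℝ) - 1)
  have h2 := measurableSet_forall_Icc_le (u := fun s w => |(U w s).2 iN|)
    (fun w => (continuous_abs.comp ((continuous_apply iN).comp (continuous_snd.comp (hc w)))))
    (fun s => (continuous_abs.measurable.comp ((measurable_pi_apply iN).comp (measurable_snd.comp (hm s))))) ht
    ((R : ℝ) - 1)
  have heq : bathGood i0 iN t U R = {w | ∀ s ∈ Icc 0 t, |(U w s).2 i0| ≤ (R : ℝ) - 1} ∩
      {w | ∀ s ∈ Icc 0 t, |(U w s).2 iN| ≤ (R : ℝ) - 1} := by
    ext w
    simp only [bathGood, mem_setOf_eq, mem_inter_iff]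
    exact ⟨fun h => ⟨fun s hs => (h s hs).1, fun s hs => (h s hs).2⟩, fun h s hs => ⟨h.1 s hs, h.2 s hs⟩⟩
  rw [heq]
  exact h1.inter h2

omit hω hl hβ hγ in
/-- The good events increase with the level. -/
theorem monotone_bathGood (U : WienerPair → ℝ → PhaseSpace N) : Monotone (bathGood i0 iN t U) := by
  intro R R' hRR' w hw s hs
  have h : (R : ℝ) ≤ R' := by exact_mod_cast hRR'
  exact ⟨(hw s hs).1.trans (by linarith), (hw s hs).2.trans (by linarith)⟩

omit hω hl hβ hγ in
/-- The good events exhaust the sample space (continuous paths are bounded on `[0, t]`). -/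
theorem exists_mem_bathGood {U : WienerPair → ℝ → PhaseSpace N} (hc : ∀ w, Continuous (U w)) (w : WienerPair) :
    ∃ R : ℕ, w ∈ bathGood i0 iN t U R := by
  obtain ⟨ρ, hρ⟩ := isCompact_Icc.exists_bound_of_continuousOn ((hc w).continuousOn (s := Icc 0 t))
  refine ⟨⌈ρ⌉₊ + 1, fun s hs => ?_⟩
  have hb : ∀ i : Fin N, |(U w s).2 i| ≤ ρ := fun i => by
    rw [← Real.norm_eq_abs]
    exact ((norm_le_pi_norm _ i).trans (norm_snd_le _)).trans (hρ s hs)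
  have hceil : ρ ≤ ((⌈ρ⌉₊ + 1 : ℕ) : ℝ) - 1 := by push_cast; linarith [Nat.le_ceil ρ]
  exact ⟨(hb i0).trans hceil, (hb iN).trans hceil⟩

end Good

/-! ### The two inequalities -/

section Main

variable {ω₂ lam β γ : ℝ} (hω : 0 < ω₂) (hl : 0 < lam) (hβ : 0 < β) (hγ : 0 < γ) (hN : 2 ≤ N)
  (i0 iN ib : Fin N) (hi0 : i0.val = 0) (hiN : iN.val = N - 1) {T_L T_R : ℝ} (hTL : 0 < T_L) (hTR : 0 < T_R)
  {t : ℝ} (ht : 0 < t) (y : PhaseSpace N)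
include hω hl hβ hγ hN hi0 hiN hTL hTR ht

omit hω hl hβ hγ hN hi0 hiN hTL hTR in
/-- The dyadic quadratic variations of both Brownian coordinates converge almost surely, in the real
parametrisation `bm1`, `bm2` of the mesh `t/2^m`. -/
theorem ae_quadVar :
    ∀ᵐ w ∂wienerPair,
      Tendsto (fun m : ℕ => ∑ k ∈ range (2 ^ m),
        (bm1 w (((k : ℝ) + 1) * (t / 2 ^ m)) - bm1 w ((k : ℝ) * (t / 2 ^ m))) ^ 2) atTop (𝓝 t) ∧
      Tendsto (fun m : ℕ => ∑ k ∈ range (2 ^ m),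
        (bm2 w (((k : ℝ) + 1) * (t / 2 ^ m)) - bm2 w ((k : ℝ) * (t / 2 ^ m))) ^ 2) atTop (𝓝 t) := by
  have hgrid : ∀ (m k : ℕ), ((k : ℝ) * (t / 2 ^ m)).toNNReal = gridTime t.toNNReal (2 ^ m) k := by
    intro m k
    have h := toNNReal_mul_div_eq_gridTime ht.le (2 ^ m) k
    push_cast at h
    exact h
  have hgrid' : ∀ (m k : ℕ), (((k : ℝ) + 1) * (t / 2 ^ m)).toNNReal = gridTime t.toNNReal (2 ^ m) (k + 1) := by
    intro m k
    have h := hgrid m (k + 1)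
    push_cast at h
    exact h
  have hsum : ∀ (ω : ℝ≥0 → ℝ) (m : ℕ), brownianQuadSum t.toNNReal (2 ^ m) ω =
      ∑ k ∈ range (2 ^ m), (brownian (((k : ℝ) + 1) * (t / 2 ^ m)).toNNReal ω -
        brownian ((k : ℝ) * (t / 2 ^ m)).toNNReal ω) ^ 2 := by
    intro ω m
    unfold brownianQuadSum
    refine Finset.sum_congr rfl fun k _ => ?_
    rw [hgrid' m k, hgrid m k]
  have ht' : ((t.toNNReal : ℝ≥0) : ℝ) = t := Real.coe_toNNReal _ ht.le
  filter_upwards [ae_tendsto_brownianQuadSum_dyadic_pair t.toNNReal] with w hw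
  rw [ht'] at hw
  simp only [hsum] at hw
  exact ⟨hw.1, hw.2⟩

/-- **(I)** `E[G(obs X) e^{W(obs X) - 2γt}] ≤ E[G(obs Z)]` for bounded continuous `G ≥ 0`. -/
theorem lintegral_obs_fwd_weighted_le (G : Obs N →ᵇ ℝ≥0) :
    ∫⁻ w, (G (rawObs (pinnedChain ω₂ lam β γ) N i0 iN ib t y (fwdPath (pinnedChain ω₂ lam β γ) N T_L T_R y w)) : ℝ≥0∞) *
        ENNReal.ofReal (Real.exp (heatFunctional T_L T_R i0 iN
          (rawObs (pinnedChain ω₂ lam β γ) N i0 iN ib t y (fwdPath (pinnedChain ω₂ lam β γ) N T_L T_R y w)) - 2 * γ * t))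
      ∂wienerPair ≤
    ∫⁻ w, (G (rawObs (pinnedChain ω₂ lam β γ) N i0 iN ib t y (thetaRevPath ω₂ lam β γ N T_L T_R y w)) : ℝ≥0∞)
      ∂wienerPair := by
  haveI := Literature.Probability.RandomPlanarGeometry.isProbabilityMeasure_preWienerMeasure'
  haveI : IsProbabilityMeasure wienerPair := by unfold wienerPair; infer_instance
  set P := pinnedChain ω₂ lam β γ with hP
  set X : WienerPair → ℝ → PhaseSpace N := fun w => fwdPath P N T_L T_R y w with hX
  set Z : WienerPair → ℝ → PhaseSpace N := fun w => thetaRevPath ω₂ lam β γ N T_L T_R y w with hZ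
  -- the scheme functionals
  set f : ℕ → ℕ → WienerPair → ℝ≥0∞ := fun R m w =>
    (G (rawObs P N i0 iN ib t y (schemePath ω₂ lam β γ N T_L T_R R t 1 1 m y w)) : ℝ≥0∞) *
      ENNReal.ofReal (Real.exp (logW ω₂ lam β γ N T_L T_R R t 1 1 m y w)) with hf
  set g : ℕ → ℕ → WienerPair → ℝ≥0∞ := fun R m w =>
    (G (rawObs P N i0 iN ib t y (schemePath ω₂ lam β γ N T_L T_R R t (-1) (-1) m y w)) : ℝ≥0∞) with hg
  have hXc : ∀ w, Continuous (X w) := fun w => continuous_fwdPath hω hl.le hβ.le hγ.le N T_L T_R y w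
  have hZc : ∀ w, Continuous (Z w) := fun w => continuous_thetaRevPath hω hl.le hβ.le hγ.le N T_L T_R y w
  have hobsX : Measurable fun w => rawObs P N i0 iN ib t y (X w) :=
    (EquilibriumBondHeatVariance.measurable_rawObs_fwdPath hω hl.le hβ.le hγ.le N T_L T_R i0 iN ib t).comp (measurable_const.prodMk measurable_id)
  have hobsZ : Measurable fun w => rawObs P N i0 iN ib t y (Z w) :=
    measurable_rawObs_thetaRevPath hω hl.le hβ.le hγ.le N T_L T_R i0 iN ib t y
  have hGm : Measurable fun p : Obs N => (G p : ℝ≥0∞) := G.continuous.measurable.coe_nnreal_ennreal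
  have hF : Measurable fun w => (G (rawObs P N i0 iN ib t y (X w)) : ℝ≥0∞) *
      ENNReal.ofReal (Real.exp (heatFunctional T_L T_R i0 iN (rawObs P N i0 iN ib t y (X w)) - 2 * γ * t)) :=
    (hGm.comp hobsX).mul (ENNReal.measurable_ofReal.comp (Real.measurable_exp.comp
      (((continuous_heatFunctional T_L T_R i0 iN).measurable.comp hobsX).sub measurable_const)))
  refine lintegral_le_of_sandwich wienerPair f g (fun R m => ?_) (fun R m => ?_) (fun R m => ?_)
    (bathGood i0 iN t X) (bathGood i0 iN t Z)
    (measurableSet_bathGood i0 iN ht.le hXc (measurable_fwdPath_apply hω hl.le hβ.le hγ.le T_L T_R y))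
    (measurableSet_bathGood i0 iN ht.le hZc (measurable_thetaRevPath_apply hω hl.le hβ.le hγ.le T_L T_R y))
    (monotone_bathGood i0 iN X) (monotone_bathGood i0 iN Z)
    (exists_mem_bathGood i0 iN hXc) (exists_mem_bathGood i0 iN hZc) _ _ hF
    (fun R => ?_) (fun R w hw => ?_) (nndist G 0) (fun R m w => ?_)
  · -- measurability of `f`
    exact (hGm.comp (measurable_rawObs_schemePath hω hl.le hβ.le γ N T_L T_R R t i0 iN ib y 1 1 m t)).mul
      (ENNReal.measurable_ofReal.comp (Real.measurable_exp.comp (measurable_logW hω hl.le hβ.le γ N T_L T_R R t y 1 1 m)))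
  · -- measurability of `g`
    exact hGm.comp (measurable_rawObs_schemePath hω hl.le hβ.le γ N T_L T_R R t i0 iN ib y (-1) (-1) m t)
  · -- the reweighting identity (DI-2)
    set D := dyScheme ω₂ lam β γ N T_L T_R R t m with hD
    have hh : 0 < D.h := by show 0 < t / 2 ^ m; positivity
    have hcL : D.cL ≠ 0 := (bathAmp_pos hγ hTL).ne'
    have hcR : D.cR ≠ 0 := (bathAmp_pos hγ hTR).ne'
    have hΨ := hGm.comp (measurable_rawObs_path_extIncr hω hl.le hβ.le γ N T_L T_R R t i0 iN ib y (-1) (-1) m t)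
    have hDI := lintegral_eq_lintegral_unshiftFin_mul (D := D) (frictionless hω hl.le hβ.le N) rfl hh (2 ^ m) y hΨ
    have hDh : D.h = t / 2 ^ m := rfl
    rw [hDh] at hDI
    simp only [hg, hf]
    refine (Eq.trans ?_ hDI).trans ?_ <;> refine lintegral_congr fun w => ?_
    · rfl
    · simp only [Function.comp_apply]
      rw [SchemeData.path_unshiftFin D hcL hcR]
      rfl
  · -- the limit of `f R m` on the good event of `X`, almost surely
    filter_upwards [ae_quadVar ht] with w hQV hw
    have hR0 : (0 : ℝ) ≤ R := Nat.cast_nonneg R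
    have hgood : ∀ s ∈ Icc 0 t, |(X w s).2 i0| ≤ (R : ℝ) - 1 ∧ |(X w s).2 iN| ≤ (R : ℝ) - 1 := hw
    have hXR : ∀ s ∈ Icc 0 t, |leftMom N (X w s)| ≤ R ∧ |rightMom N (X w s)| ≤ R := fun s hs => by
      rw [leftMom_eq hN i0 hi0, rightMom_eq hN iN hiN]
      exact ⟨(hgood s hs).1.trans (by linarith), (hgood s hs).2.trans (by linarith)⟩
    have hconv := tendsto_schemePath_fwd hω hl.le hβ.le hγ.le N T_L T_R ht hR0 y w hXR
    have hobs := tendsto_rawObs_of_unif ω₂ lam β γ i0 iN ib ht.le y (hXc w)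
      (fun m => continuous_schemePath hω hl.le hβ.le γ N T_L T_R R t 1 1 m y w) hconv
    have hGt : Tendsto (fun m : ℕ => (G (rawObs P N i0 iN ib t y (schemePath ω₂ lam β γ N T_L T_R R t 1 1 m y w)) : ℝ≥0∞))
        atTop (𝓝 (G (rawObs P N i0 iN ib t y (X w)) : ℝ≥0∞)) :=
      (ENNReal.continuous_coe.tendsto _).comp ((G.continuous.tendsto _).comp hobs)
    have hW := tendsto_logW_damped hω hl hβ hγ hN i0 iN ib hi0 hiN hTL hTR ht R y w hgood hQV.1 hQV.2
    have hE : Tendsto (fun m : ℕ => ENNReal.ofReal (Real.exp (logW ω₂ lam β γ N T_L T_R R t 1 1 m y w))) atTop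
        (𝓝 (ENNReal.ofReal (Real.exp (heatFunctional T_L T_R i0 iN (rawObs P N i0 iN ib t y (X w)) - 2 * γ * t)))) :=
      (ENNReal.continuous_ofReal.tendsto _).comp ((Real.continuous_exp.tendsto _).comp hW)
    exact ENNReal.Tendsto.mul hGt (Or.inr ENNReal.ofReal_ne_top) hE (Or.inr ENNReal.coe_ne_top)
  · -- the limit of `g R m` on the good event of `Z`
    have hR0 : (0 : ℝ) ≤ R := Nat.cast_nonneg R
    have hgood : ∀ s ∈ Icc 0 t, |(Z w s).2 i0| ≤ (R : ℝ) - 1 ∧ |(Z w s).2 iN| ≤ (R : ℝ) - 1 := hw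
    have hZR : ∀ s ∈ Icc 0 t, |leftMom N (Z w s)| ≤ R ∧ |rightMom N (Z w s)| ≤ R := fun s hs => by
      rw [leftMom_eq hN i0 hi0, rightMom_eq hN iN hiN]
      exact ⟨(hgood s hs).1.trans (by linarith), (hgood s hs).2.trans (by linarith)⟩
    have hconv := tendsto_schemePath_anti hω hl.le hβ.le hγ.le N T_L T_R ht hR0 y w hZR
    have hobs := tendsto_rawObs_of_unif ω₂ lam β γ i0 iN ib ht.le y (hZc w)
      (fun m => continuous_schemePath hω hl.le hβ.le γ N T_L T_R R t (-1) (-1) m y w) hconv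
    exact (ENNReal.continuous_coe.tendsto _).comp ((G.continuous.tendsto _).comp hobs)
  · -- the uniform bound
    exact ENNReal.coe_le_coe.2 (BoundedContinuousFunction.NNReal.upper_bound G _)

/-- **(II)** `E[G(obs Z) e^{-W(obs Z) + 2γt}] ≤ E[G(obs X)]` for bounded continuous `G ≥ 0`. -/
theorem lintegral_obs_anti_weighted_le (G : Obs N →ᵇ ℝ≥0) :
    ∫⁻ w, (G (rawObs (pinnedChain ω₂ lam β γ) N i0 iN ib t y (thetaRevPath ω₂ lam β γ N T_L T_R y w)) : ℝ≥0∞) *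
        ENNReal.ofReal (Real.exp (-heatFunctional T_L T_R i0 iN
          (rawObs (pinnedChain ω₂ lam β γ) N i0 iN ib t y (thetaRevPath ω₂ lam β γ N T_L T_R y w)) + 2 * γ * t))
      ∂wienerPair ≤
    ∫⁻ w, (G (rawObs (pinnedChain ω₂ lam β γ) N i0 iN ib t y (fwdPath (pinnedChain ω₂ lam β γ) N T_L T_R y w)) : ℝ≥0∞)
      ∂wienerPair := by
  haveI := Literature.Probability.RandomPlanarGeometry.isProbabilityMeasure_preWienerMeasure'
  haveI : IsProbabilityMeasure wienerPair := by unfold wienerPair; infer_instance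
  set P := pinnedChain ω₂ lam β γ with hP
  set X : WienerPair → ℝ → PhaseSpace N := fun w => fwdPath P N T_L T_R y w with hX
  set Z : WienerPair → ℝ → PhaseSpace N := fun w => thetaRevPath ω₂ lam β γ N T_L T_R y w with hZ
  -- the scheme functionals
  set f : ℕ → ℕ → WienerPair → ℝ≥0∞ := fun R m w =>
    (G (rawObs P N i0 iN ib t y (schemePath ω₂ lam β γ N T_L T_R R t (-1) (-1) m y w)) : ℝ≥0∞) *
      ENNReal.ofReal (Real.exp (logW ω₂ lam β γ N T_L T_R R t (-1) (-1) m y w)) with hf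
  set g : ℕ → ℕ → WienerPair → ℝ≥0∞ := fun R m w =>
    (G (rawObs P N i0 iN ib t y (schemePath ω₂ lam β γ N T_L T_R R t 1 1 m y w)) : ℝ≥0∞) with hg
  have hXc : ∀ w, Continuous (X w) := fun w => continuous_fwdPath hω hl.le hβ.le hγ.le N T_L T_R y w
  have hZc : ∀ w, Continuous (Z w) := fun w => continuous_thetaRevPath hω hl.le hβ.le hγ.le N T_L T_R y w
  have hobsX : Measurable fun w => rawObs P N i0 iN ib t y (X w) :=
    (EquilibriumBondHeatVariance.measurable_rawObs_fwdPath hω hl.le hβ.le hγ.le N T_L T_R i0 iN ib t).comp (measurable_const.prodMk measurable_id)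
  have hobsZ : Measurable fun w => rawObs P N i0 iN ib t y (Z w) :=
    measurable_rawObs_thetaRevPath hω hl.le hβ.le hγ.le N T_L T_R i0 iN ib t y
  have hGm : Measurable fun p : Obs N => (G p : ℝ≥0∞) := G.continuous.measurable.coe_nnreal_ennreal
  have hF : Measurable fun w => (G (rawObs P N i0 iN ib t y (Z w)) : ℝ≥0∞) *
      ENNReal.ofReal (Real.exp (-heatFunctional T_L T_R i0 iN (rawObs P N i0 iN ib t y (Z w)) + 2 * γ * t)) :=
    (hGm.comp hobsZ).mul (ENNReal.measurable_ofReal.comp (Real.measurable_exp.comp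
      (((continuous_heatFunctional T_L T_R i0 iN).measurable.comp hobsZ).neg.add measurable_const)))
  refine lintegral_le_of_sandwich wienerPair f g (fun R m => ?_) (fun R m => ?_) (fun R m => ?_)
    (bathGood i0 iN t Z) (bathGood i0 iN t X)
    (measurableSet_bathGood i0 iN ht.le hZc (measurable_thetaRevPath_apply hω hl.le hβ.le hγ.le T_L T_R y))
    (measurableSet_bathGood i0 iN ht.le hXc (measurable_fwdPath_apply hω hl.le hβ.le hγ.le T_L T_R y))
    (monotone_bathGood i0 iN Z) (monotone_bathGood i0 iN X)
    (exists_mem_bathGood i0 iN hZc) (exists_mem_bathGood i0 iN hXc) _ _ hF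
    (fun R => ?_) (fun R w hw => ?_) (nndist G 0) (fun R m w => ?_)
  · -- measurability of `f`
    exact (hGm.comp (measurable_rawObs_schemePath hω hl.le hβ.le γ N T_L T_R R t i0 iN ib y (-1) (-1) m t)).mul
      (ENNReal.measurable_ofReal.comp (Real.measurable_exp.comp
        (measurable_logW hω hl.le hβ.le γ N T_L T_R R t y (-1) (-1) m)))
  · -- measurability of `g`
    exact hGm.comp (measurable_rawObs_schemePath hω hl.le hβ.le γ N T_L T_R R t i0 iN ib y 1 1 m t)
  · -- the reweighting identity (DI-1)
    set D := dyScheme ω₂ lam β γ N T_L T_R R t m with hD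
    have hh : 0 < D.h := by show 0 < t / 2 ^ m; positivity
    have hcL : D.cL ≠ 0 := (bathAmp_pos hγ hTL).ne'
    have hcR : D.cR ≠ 0 := (bathAmp_pos hγ hTR).ne'
    have hΨ := hGm.comp (measurable_rawObs_path_extIncr hω hl.le hβ.le γ N T_L T_R R t i0 iN ib y 1 1 m t)
    have hDI := lintegral_eq_lintegral_shiftFin_mul (D := D) (frictionless hω hl.le hβ.le N) rfl hh (2 ^ m) y hΨ
    have hDh : D.h = t / 2 ^ m := rfl
    rw [hDh] at hDI
    simp only [hg, hf]
    refine (Eq.trans ?_ hDI).trans ?_ <;> refine lintegral_congr fun w => ?_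
    · rfl
    · simp only [Function.comp_apply]
      rw [SchemeData.path_shiftFin D hcL hcR]
      rfl
  · -- the limit of `f R m` on the good event of `Z`, almost surely
    filter_upwards [ae_quadVar ht] with w hQV hw
    have hR0 : (0 : ℝ) ≤ R := Nat.cast_nonneg R
    have hgood : ∀ s ∈ Icc 0 t, |(Z w s).2 i0| ≤ (R : ℝ) - 1 ∧ |(Z w s).2 iN| ≤ (R : ℝ) - 1 := hw
    have hZR : ∀ s ∈ Icc 0 t, |leftMom N (Z w s)| ≤ R ∧ |rightMom N (Z w s)| ≤ R := fun s hs => by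
      rw [leftMom_eq hN i0 hi0, rightMom_eq hN iN hiN]
      exact ⟨(hgood s hs).1.trans (by linarith), (hgood s hs).2.trans (by linarith)⟩
    have hconv := tendsto_schemePath_anti hω hl.le hβ.le hγ.le N T_L T_R ht hR0 y w hZR
    have hobs := tendsto_rawObs_of_unif ω₂ lam β γ i0 iN ib ht.le y (hZc w)
      (fun m => continuous_schemePath hω hl.le hβ.le γ N T_L T_R R t (-1) (-1) m y w) hconv
    have hGt : Tendsto (fun m : ℕ =>
        (G (rawObs P N i0 iN ib t y (schemePath ω₂ lam β γ N T_L T_R R t (-1) (-1) m y w)) : ℝ≥0∞))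
        atTop (𝓝 (G (rawObs P N i0 iN ib t y (Z w)) : ℝ≥0∞)) :=
      (ENNReal.continuous_coe.tendsto _).comp ((G.continuous.tendsto _).comp hobs)
    have hW := tendsto_logW_anti hω hl hβ hγ hN i0 iN ib hi0 hiN hTL hTR ht R y w hgood hQV.1 hQV.2
    have hE : Tendsto (fun m : ℕ => ENNReal.ofReal (Real.exp (logW ω₂ lam β γ N T_L T_R R t (-1) (-1) m y w))) atTop
        (𝓝 (ENNReal.ofReal (Real.exp (-heatFunctional T_L T_R i0 iN (rawObs P N i0 iN ib t y (Z w)) + 2 * γ * t)))) :=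
      (ENNReal.continuous_ofReal.tendsto _).comp ((Real.continuous_exp.tendsto _).comp hW)
    exact ENNReal.Tendsto.mul hGt (Or.inr ENNReal.ofReal_ne_top) hE (Or.inr ENNReal.coe_ne_top)
  · -- the limit of `g R m` on the good event of `X`
    have hR0 : (0 : ℝ) ≤ R := Nat.cast_nonneg R
    have hgood : ∀ s ∈ Icc 0 t, |(X w s).2 i0| ≤ (R : ℝ) - 1 ∧ |(X w s).2 iN| ≤ (R : ℝ) - 1 := hw
    have hXR : ∀ s ∈ Icc 0 t, |leftMom N (X w s)| ≤ R ∧ |rightMom N (X w s)| ≤ R := fun s hs => by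
      rw [leftMom_eq hN i0 hi0, rightMom_eq hN iN hiN]
      exact ⟨(hgood s hs).1.trans (by linarith), (hgood s hs).2.trans (by linarith)⟩
    have hconv := tendsto_schemePath_fwd hω hl.le hβ.le hγ.le N T_L T_R ht hR0 y w hXR
    have hobs := tendsto_rawObs_of_unif ω₂ lam β γ i0 iN ib ht.le y (hXc w)
      (fun m => continuous_schemePath hω hl.le hβ.le γ N T_L T_R R t 1 1 m y w) hconv
    exact (ENNReal.continuous_coe.tendsto _).comp ((G.continuous.tendsto _).comp hobs)
  · -- the uniform bound
    exact ENNReal.coe_le_coe.2 (BoundedContinuousFunction.NNReal.upper_bound G _)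

end Main

/-- **The good events exhaust the raw sample space** — `∀`-form registered as a sub-goal of the crux item. -/
theorem bathGood_exhaust :
    ∀ (N : ℕ) (i0 iN : Fin N) (t : ℝ) (U : WienerPair → ℝ → PhaseSpace N), (∀ w, Continuous (U w)) → ∀ (w : WienerPair), ∃ R : ℕ, w ∈ bathGood i0 iN t U R :=
  fun _ i0 iN _ _ hc w => exists_mem_bathGood i0 iN hc w

end Summit.AtomisticToContinuum.FouriersLaw.Theorems.LinearResponseFTUR

end
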